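import Mathlib
import HarnessLib
import Summits.NavierStokesRegularity.NavierStokesRegularity.Theorems.HalfSpaceWindowDoorCirculationCarryingRigidityDefs
import Summits.NavierStokesRegularity.NavierStokesRegularity.Theorems.HalfSpaceWindowDoorCirculationCarryingRigidityReduction
import Summits.NavierStokesRegularity.NavierStokesRegularity.Theorems.HalfSpaceWindowDoorCirculationCarryingRigidityExtremalProfile

/-!
# Route `HalfSpaceWindowDoor`, crux `CirculationCarryingRigidity` (stmt-NavierStokesRegularity-25311) — the re-typed research
# stub `NoExtremalHemisphereProfile` (Defs, p620979) BY NAME: equivalence with the open stub and the one-line closer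

With `NoExtremalHemisphereProfile` now a tree definition (`…Defs`, the right-hand side of
`…ExtremalProfile.hemisphereLiouvilleE3_iff_no_extremal` verbatim), this file records, by name:

* `hemisphereLiouvilleE3_iff_noExtremalHemisphereProfile` — `HemisphereLiouvilleE3 ↔ NoExtremalHemisphereProfile`;
* `stubLayerExclusion_iff_noExtremalHemisphereProfile` — the registered open stub `StubLayerExclusion` of the skeleton of record
  is equivalent to it (through g0's `stubLayerExclusion_iff_hemisphereLiouvilleE3`);
* `circulationCarryingRigidity_of_noExtremalHemisphereProfile` — **the one-line closer**: a proof of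
  `NoExtremalHemisphereProfile` gives the route decl `CirculationCarryingRigidity` BY NAME (the composition of the proposed
  line `Cruxes/CirculationCarryingRigidity/Lines/extremal.lean`).

Seat ns-hsw-p1 g2 (LEAD of 25311, cell pub-ns-dss).  WHAT THIS IS NOT: not a statement about Navier–Stokes regularity and not
a closure of the item — bookkeeping for the re-typed stub (hypothetical blow-up profiles); helper `--supports` 25311.
-/

noncomputable section

-- the summit and its single sub-problem share the name (CONVENTIONS §1), as in every Theorems file
set_option linter.dupNamespace false

namespace Summit.NavierStokesRegularity.NavierStokesRegularity.Theorems.HalfSpaceWindowDoorCirculationCarryingRigidityExtremalReduction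

open Summit.NavierStokesRegularity.NavierStokesRegularity.Theses.HalfSpaceWindowDoor
open Summit.NavierStokesRegularity.NavierStokesRegularity.Theorems.HalfSpaceWindowDoorCirculationCarryingRigidityDefs
open Summit.NavierStokesRegularity.NavierStokesRegularity.Theorems.HalfSpaceWindowDoorCirculationCarryingRigidityReduction
  (stubLayerExclusion_iff_hemisphereLiouvilleE3 circulationCarryingRigidity_of_hemisphereLiouvilleE3)
open Summit.NavierStokesRegularity.NavierStokesRegularity.Theorems.HalfSpaceWindowDoorCirculationCarryingRigidityExtremalProfile
  (hemisphereLiouvilleE3_iff_no_extremal)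

/-- **`HemisphereLiouvilleE3 ↔ NoExtremalHemisphereProfile`** (the tree theorem `hemisphereLiouvilleE3_iff_no_extremal`, whose
right-hand side is the Defs text verbatim). -/
theorem hemisphereLiouvilleE3_iff_noExtremalHemisphereProfile : HemisphereLiouvilleE3 ↔ NoExtremalHemisphereProfile :=
  hemisphereLiouvilleE3_iff_no_extremal

/-- **The registered open stub is equivalent to the re-typed one**: `StubLayerExclusion ↔ NoExtremalHemisphereProfile`. -/
theorem stubLayerExclusion_iff_noExtremalHemisphereProfile : StubLayerExclusion ↔ NoExtremalHemisphereProfile :=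
  stubLayerExclusion_iff_hemisphereLiouvilleE3.trans hemisphereLiouvilleE3_iff_no_extremal

/-- **One-line closer for the re-typed stub**: `NoExtremalHemisphereProfile → CirculationCarryingRigidity` (route decl BY NAME). -/
theorem circulationCarryingRigidity_of_noExtremalHemisphereProfile (h : NoExtremalHemisphereProfile) :
    CirculationCarryingRigidity :=
  circulationCarryingRigidity_of_hemisphereLiouvilleE3 (hemisphereLiouvilleE3_iff_no_extremal.2 h)

end Summit.NavierStokesRegularity.NavierStokesRegularity.Theorems.HalfSpaceWindowDoorCirculationCarryingRigidityExtremalReduction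

end
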